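import Summits.KontsevichZagierPeriods.KontsevichZagierPeriods.Theses.SymplecticScissors

/-!
# Route SymplecticScissors — `FrameSplit` (item stmt-KontsevichZagierPeriods-14942)

The frame splits by dimension: the planar layer `PlanarAreas` (dimension `N = 2`) together with the
off-plane frame `VolumeFormOffPlane` (every dimension `N ≠ 2`) gives `VolumeForm`, the one
hypothesis of the route's `closes` theorem. The proof is a case split on `N = 2`.

The converse restrictions (`VolumeForm ↔ PlanarAreas ∧ VolumeFormOffPlane`) are recorded in the
companion helper file `SymplecticScissorsFrameSplitConverse.lean`: the glue item neither weakens nor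
strengthens the frame.
-/

namespace Summit.KontsevichZagierPeriods.KontsevichZagierPeriods.Theses.SymplecticScissors
open scoped BigOperators Topology Manifold Classical MeasureTheory ProbabilityTheory Matrix InnerProductSpace ComplexConjugate ContinuousMap in
open Filter Set Function TopologicalSpace MeasureTheory in
open Literature Periods in
/-- **Record of the dropped route item `FrameSplit`** = stmt-KontsevichZagierPeriods-14942 (ledger signature verbatim; NOT a route
item): route SymplecticScissors dropped the item `FrameSplit` (stmt-14942) in a later re-cut. The declaration `Summit.KontsevichZagierPeriods.KontsevichZagierPeriods.Theses.SymplecticScissors.FrameSplit`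
therefore no longer exists in the route file and this accepted module stopped elaborating (stale olean;
buildfix lane 2026-08-19). Re-created here under its original name so the result keeps building; the
statement of every previously accepted declaration in this file is unchanged. -/
def FrameSplit : Prop :=
  PlanarAreas → VolumeFormOffPlane → VolumeForm
end Summit.KontsevichZagierPeriods.KontsevichZagierPeriods.Theses.SymplecticScissors


namespace Summit.KontsevichZagierPeriods.SymplecticScissors

/-- **FrameSplit** (route SymplecticScissors, item stmt-KontsevichZagierPeriods-14942):
`PlanarAreas → VolumeFormOffPlane → VolumeForm`. Given two integrand-1 representations `r r'` of a
common dimension `N` with equal value, either `N = 2` and the planar layer `PlanarAreas` applies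
verbatim, or `N ≠ 2` and the off-plane frame `VolumeFormOffPlane` applies verbatim. -/
theorem frameSplit_proof :
    Summit.KontsevichZagierPeriods.KontsevichZagierPeriods.Theses.SymplecticScissors.FrameSplit := by
  unfold Summit.KontsevichZagierPeriods.KontsevichZagierPeriods.Theses.SymplecticScissors.FrameSplit
  intro h2 hoff N r r' hr hr' hv
  by_cases hN : N = 2
  · subst hN
    exact h2 r r' hr hr' hv
  · exact hoff hN r r' hr hr' hv

end Summit.KontsevichZagierPeriods.SymplecticScissors
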